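import Summits.BirchSwinnertonDyer.Rank1Residual.Additive.PotMultUnitRowCoeffCert
import Summits.BirchSwinnertonDyer.Rank1Residual.Additive.CensusQ6UnitCoeffCertificate
import HarnessLib

/-!
# Q6 calibration, locus (M): on the UNIT rows the first-unit-index record has `n₀ = 0` BY THEOREM
# (cell `b2b-bsdres`, team n1011, seat n1011-p06 gen 2 — Q6 register owner; P0 of PREDICTIONS-Q6 on the
# 20 (M) calibration rows; (M) twin of census-ctyper-1's `CensusQ6.gord[Odd]FirstUnitIndexAt_zero_of_unitLValue`)

HONEST FRAMING (cell `b2b-bsdres`, run/shared/lean/b2b/bsd-rank1-residual/, verbatim in every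
file): the goal of the cell is to DELETE the COMBINATION-SHAPED residual classes of the
Birch–Swinnerton-Dyer formula for ALL analytic-rank `≤ 1` elliptic curves over `ℚ` — "full BSD
formula for every rank `≤ 1` curve in class `C`" assembled STRICTLY from published theorems — so
that the rank-`≤ 1` remainder becomes exactly the CONSTRUCTION-SHAPED classes, which are TYPED
(missing-input `Prop`s), NOT attempted. This is not "finishing BSD". Team n1011 (X4 ∧ `p = 3` / the
additive block): research routes; census output = EVIDENCE (hypothesis instances), never a Literature
fact; X4(M) stays CONSTRUCTION-SHAPED; labels / census / located gap UNCHANGED; nothing is booked.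
Theorems only (no definition, no named fact; the only Literature input is modularity `hmod`).

## What and why

PREDICTIONS-Q6 (cells/n1011/PREDICTIONS-Q6.md) §5 prediction P0 says the instrument returns
`n₀ = 0` on the 40 calibration rows (unit rows: `L(E,1) = q·Ω_E`, `ord_p q = 0`). census-ctyper-1
(p253484) proved the kernel side of P0 for the 20 GordTwo-ord calibration rows
(`CensusQ6.gord[Odd]FirstUnitIndexAt_zero_of_unitLValue`); this file is the (M) half — the records
`CensusQ6.MultOddFirstUnitIndexAt W p 0` (`p ≡ 3 (mod 4)`, `p = 3` included: 10 rows at `3`) and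
`CensusQ6.MultFirstUnitIndexAt W p 0` (`p ≡ 1 (mod 4)`) HOLD on the unit rows, by this seat's
`norm_constantCoeff_{minus,plus}BranchMult_eq_one_of_unitLValue` (p255889: the constant term of the
Néron-normalised branch of the multiplicative twist is `ϖ·a_p⁻¹·S^∓` with `a_p = ±1` and
`ϖ·S⁻ = c_∞(E)·q` / `ϖ·S⁺ = q`, signed Birch–Gauss–Pal identities PROVED). So a Stage A output with
`n₀ ≠ 0` on ANY calibration row is an instrument defect, never an anomaly (P0 as registered). Consumer
list `HOME/b2b-bsdres-n1011-p06/q6/Q6-stageA-consumers-v4.tsv`, column `record_predicate`, rows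
`calibration … M`. Nothing booked; no label change; zero compute.

References: Mazur–Tate–Teitelbaum, Invent. Math. 84 (1986) §I.10 (10.1), §I.13 [MazurTateTeitelbaum1986Invent];
A. Pal, Proc. AMS (2012) Thm. 3.2 [Pal2012].
-/

noncomputable section

open scoped Classical MatrixGroups ModularForm NumberField

open CongruenceSubgroup WeierstrassCurve NumberField Literature.NumberTheory.EllipticCurves
  Literature.NumberTheory.EllipticCurves.ModularForms
  Literature.NumberTheory.EllipticCurves.Rank1Residual
  Literature.NumberTheory.EllipticCurves.Rank1Residual.Typed

namespace Summit.BirchSwinnertonDyer.Rank1Residual.Additive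

namespace CensusQ6

variable {W : WeierstrassCurve ℚ} [W.IsElliptic] [W.IsGloballyMinimal] {p : ℕ} [hp : Fact p.Prime]

/-- **Unit rows, locus (M), odd branch (`p ≡ 3 (mod 4)`, `p = 3` included): `n₀ = 0`.** If
`L(E,1) = q·Ω_E`, `q ≠ 0`, `ord_p q = 0` and `W` is additive at `p`, then the record
`MultOddFirstUnitIndexAt W p 0` HOLDS: for every multiplicative twist model `V` (`C • V^{(−p)} = W`),
newform `f`, `a_p(f) = ap`, `ϖ·|Ω⁻(V)| = Ω⁻_f`, `‖c_0‖ = ‖ϖ·ap⁻¹·S⁻‖_p = ‖c_∞(E)·q‖_p = 1`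
(`norm_constantCoeff_minusBranchMult_eq_one_of_unitLValue`).
[cite: MazurTateTeitelbaum1986Invent, §I.10 (10.1), §I.13] [cite: Pal2012, Thm. 3.2] -/
theorem multOddFirstUnitIndexAt_zero_of_unitLValue (hmod : hasEntireLFunction_rat) (hp4 : p % 4 = 3)
    (hadd : Addv W p) {q : ℚ} (hq : W.entireLFunction 1 = (q : ℂ) * (W.realPeriodRat : ℂ))
    (hq0 : q ≠ 0) (hv : padicValRat p q = 0) : MultOddFirstUnitIndexAt W p 0 := by
  intro V _ _ C hV hC N _ f hf ap hap ϖ hϖ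
  refine ⟨fun m hm => absurd hm (Nat.not_lt_zero m), ?_⟩
  rw [PowerSeries.coeff_zero_eq_constantCoeff_apply]
  exact norm_constantCoeff_minusBranchMult_eq_one_of_unitLValue hmod hp4 hadd V C hC hV hf hap ϖ hϖ hq
    hq0 hv

/-- **Unit rows, locus (M), even branch (`p ≡ 1 (mod 4)`): `n₀ = 0`** — the record
`MultFirstUnitIndexAt W p 0` HOLDS (`‖c_0‖ = ‖ϖ·ap⁻¹·S⁺‖_p = ‖q‖_p = 1`,
`norm_constantCoeff_plusBranchMult_eq_one_of_unitLValue`).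
[cite: MazurTateTeitelbaum1986Invent, §I.10 (10.1), §I.13] [cite: Pal2012, Thm. 3.2] -/
theorem multFirstUnitIndexAt_zero_of_unitLValue (hmod : hasEntireLFunction_rat) (hp4 : p % 4 = 1)
    (hadd : Addv W p) {q : ℚ} (hq : W.entireLFunction 1 = (q : ℂ) * (W.realPeriodRat : ℂ))
    (hq0 : q ≠ 0) (hv : padicValRat p q = 0) : MultFirstUnitIndexAt W p 0 := by
  intro V _ _ C hV hC N _ f hf ap hap ϖ hϖ
  refine ⟨fun m hm => absurd hm (Nat.not_lt_zero m), ?_⟩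
  rw [PowerSeries.coeff_zero_eq_constantCoeff_apply]
  exact norm_constantCoeff_plusBranchMult_eq_one_of_unitLValue hmod hp4 hadd V C hC hV hf hap ϖ hϖ hq
    hq0 hv

/-- **X4(M) calibration rows: the record at index `0` from the class predicate** (`Addv` read off
`AdditivePotMult.ClassX4M W p`), odd branch. [cite: MazurTateTeitelbaum1986Invent, §I.13] -/
theorem multOddFirstUnitIndexAt_zero_of_classX4M_of_unitLValue (hmod : hasEntireLFunction_rat)
    (hp4 : p % 4 = 3) (hX : AdditivePotMult.ClassX4M W p)
    {q : ℚ} (hq : W.entireLFunction 1 = (q : ℂ) * (W.realPeriodRat : ℂ)) (hq0 : q ≠ 0)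
    (hv : padicValRat p q = 0) : MultOddFirstUnitIndexAt W p 0 :=
  multOddFirstUnitIndexAt_zero_of_unitLValue hmod hp4 hX.potMult.1 hq hq0 hv

/-- **X4(M) calibration rows: the record at index `0` from the class predicate**, even branch.
[cite: MazurTateTeitelbaum1986Invent, §I.13] -/
theorem multFirstUnitIndexAt_zero_of_classX4M_of_unitLValue (hmod : hasEntireLFunction_rat)
    (hp4 : p % 4 = 1) (hX : AdditivePotMult.ClassX4M W p)
    {q : ℚ} (hq : W.entireLFunction 1 = (q : ℂ) * (W.realPeriodRat : ℂ)) (hq0 : q ≠ 0)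
    (hv : padicValRat p q = 0) : MultFirstUnitIndexAt W p 0 :=
  multFirstUnitIndexAt_zero_of_unitLValue hmod hp4 hX.potMult.1 hq hq0 hv

end CensusQ6

end Summit.BirchSwinnertonDyer.Rank1Residual.Additive

end
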